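import Summits.QuantumFields.YangMills.Theorems.BalabanUVNodesN07DatumCrownOfRecordCrown
import Literature.MathematicalPhysics.QuantumFieldTheory.Balaban1983to89.B8Prop6DentedCubeMemberScalarGammaSURec
import Literature.MathematicalPhysics.QuantumFieldTheory.Balaban1983to89.B8Prop6DentedCubeMemberScalarGammaSU25Rec
import HarnessLib

/-!
# N07 [B11] (= [15] = [Balaban1985Variational]) Sect. F — **THE N05-REC → K-ROAD JUNCTION, END TO END**: the `SU(N)` record crown (dag-n05-e R8 (G8)) ⟹ `RecordCrownSU F.L N` ⟹
# `HThm4RecMember` AT THE PRINT LETTERS, COLLAR-UNIFORMLY, WITH NO R6 PREMISE DISPLAYED (`N ≤ 12`)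

Cell `pub-ymgap`, width seat `pub-ymgap-dag-n07-w3` g12 (N05-REC R7 → THE KNIT).  `--kind proof --supports stmt-QuantumFields-20541 --as helper` (K0⁷; count-neutral).  Theorems only.
[6] = [Balaban1985RegularSpaces]; [15] = [Balaban1985Variational]; [3] = [Balaban1985Averaging]; [4] = [Balaban1985BackgroundPropagators]; [I] = [Balaban1987RG1].

WHY.  p735717 (`…N07DatumCrownOfRecordCrown`) proved the junction modulo ONE displayed premise shape `RecordCrownSU F.L N` = [6] Proposition 6 as `GaugedBoundB8DZ`'s ∃-body at every
dented record datum on print's p. 98 sub-lattice, `d = 4`, `𝔸 = M_N(ℂ)`, the three membership clauses in `SU(N)`.  dag-n05-e's R8 (the `G∕τ` edition of the record crown: the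
Thm-4 driver with the invariant `u ∈ G` — heads `B8Thm4KLevelGammaGRec` ∕ `B8Thm4ExistsAtGammaGRec` ∕ `B8Prop6DentedCubeMemberGammaGRec` (this seat) —, Sect. E's fixed point with the
exponent `λ` trace-free, the (g)-tail in `G`-form, and the `SU(N)` instance at `τ := tr`, `H := SL(N,ℂ)`, `AvgClosedZ d L (SU N)` for `N ≤ 12`) INHABITS that shape:
`B8Prop6DentedCubeMemberScalarGammaSURec.gaugedBoundB8DZ_dentedMember_scalar_γ_holds_specialUnitary` (UNCONDITIONAL: the two Cov facts are n05-cov's theorems ✓p733782 ∕ ✓p734150, consumed inside R8's (G7)).  THIS FILE is the destructuring bridge (G8 at `d := 4`, `L := F.L = 2·sL + 1`, `sL ≥ 2` from `F.hL`, `F.hL11`) and the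
END-TO-END junction theorem.

WHAT IS PROVED (kernel; composition by name).
* §1 ★★ `recordCrownSU_holds (hN : N ≤ 12) : RecordCrownSU F.L N`.
* §3 (appended) `recordCrownSU_holds_of_le` ∕ ★★★ `hThm4RecMember_uniform_holds_of_le` — the same for `N ≤ 25` over dag-n05-e g41's `…ScalarGammaSU25Rec` (sharp record `SU(N)` closure).
* §2 ★★★ `hThm4RecMember_uniform_holds (hN : N ≤ 12) (Mc : ℕ) : ∃ ρmin B₁ c₁′, 1 ≤ ρmin ∧ 0 ≤ B₁ ∧ 0 < c₁′ ∧ ∀ ρ₀, ρmin ∣ ρ₀ → 1 ≤ ρ₀ → ∀ hρ,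
  HThm4RecMember F N Mc (ρ₀·L) hρ (b9OfP F Mc (ρ₀·L) B₁) (a0OfP F N Mc (ρ₀·L) B₁ c₁′)` — dag-n07-e's 88″ §2 quantifiers with `HThm4RecDbar ↦ HThm4RecMember`, NO R6 premise.
HONEST FRAMING: count-neutral; composition by name; the (e)-step `HThm4RecMember → HThm4RecDbar` (the `Nrm` row; ruling A3⁵) is NOT produced, so `HThm4RecDbar(Uniform)` ∕ `HThm4Rec`
remain UNDISCHARGED (caveat (C-S3-1)); `N ≤ 12` displayed; N05 ∕ N07 NOT discharged; K0⁷ ∕ K1⁹ NOT closed; counts unmoved (typed 28∕28 · discharged 8∕27); one finite 𝕋⁴ programme at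
fixed ε — R4 closes the conditional finite-𝕋⁴ rung `BalabanLadder.UV` ONLY; the YM mass gap (Clay) is NOT proved by any of this; nothing continuum ∕ ℝ⁴ ∕ OS.

References: [6] Thm. 4 p. 88, Prop. 6 (1.130)–(1.138) pp. 98–99, (1.29) p. 81, (1.59) p. 86, p. 76; [15] (144) p. 300, (147)–(153) p. 301, (163) p. 304; [3] p. 20, (42)–(43) pp. 23–24;
[4] Thm 3.3 p. 399; [I] (0.3)–(0.4) pp. 252–253, (0.11) pp. 253–254.
-/

set_option autoImplicit false

noncomputable section

open scoped BigOperators Matrix.Norms.L2Operator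

namespace Summit.QuantumFields.YangMills.BalabanUVNodes.N07Thm4RecMemberOfRecordCrownSU

open Literature.MathematicalPhysics.QuantumFieldTheory.Balaban1983to89
open Literature.MathematicalPhysics.QuantumFieldTheory.Balaban1983to89.Node00
open T4Continuum (T4Family)
open N07Thm4RecMemberOfCrown (HThm4RecMember)
open N07DatumCrownOfRecordCrown (RecordCrownSU RecordCrownSUBody hThm4RecMember_uniform_of_recordCrownSU)

variable (F : T4Family) (N : ℕ) [NeZero N]

/-! ## §1  The `SU(N)` record crown inhabits `RecordCrownSU F.L N` -/

/-- ★★ **THE `SU(N)` RECORD CROWN INHABITS THE JUNCTION's PREMISE SHAPE**: for `N ≤ 12` (the record's averaging-closedness of `SU(N)`, `B7Prop2SpecialUnitaryRec.avgClosedZ_specialUnitary`),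
`RecordCrownSU F.L N` — dag-n05-e's R8 (G8) at `d := 4`, `L := F.L = 2·sL + 1` (`F.hL.1`), `sL ≥ 2` (`F.hL11 : 11 < L`).
[cite: Balaban1985RegularSpaces, Prop. 6 (1.135)–(1.138) p.99, p.98, p.76 («G = SU(N)»); Balaban1985Variational, (152)–(153) p.301; Balaban1985Averaging, p.20, (42)–(43) pp.23–24; Balaban1987RG1, (0.3)–(0.4) pp.252–253] -/
theorem recordCrownSU_holds (hN : N ≤ 12) : RecordCrownSU F.L N := by
  obtain ⟨sL, hsL⟩ := F.hL.1
  have hs2 : 2 ≤ sL := by have := F.hL11; omega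
  letI : CStarAlgebra (MatA N) := {}
  exact B8Prop6DentedCubeMemberScalarGammaSURec.gaugedBoundB8DZ_dentedMember_scalar_γ_holds_specialUnitary (d := 4) (by norm_num) hsL hs2 hN

/-! ## §2  The junction, end to end -/

/-- ★★★ **THE N05-REC → K-ROAD JUNCTION, END TO END**: for `N ≤ 12` and every grid side `Mc` there are a collar modulus `ρmin ≥ 1` and ONE witness `(B₁, c₁′)` such that at every collar
`ρ₀·L` with `ρmin ∣ ρ₀`, `ρ₀ ≥ 1`: `HThm4RecMember F N Mc (ρ₀·L) hρ (b9OfP F Mc (ρ₀·L) B₁) (a0OfP F N Mc (ρ₀·L) B₁ c₁′)` — [6] Prop. 6 ∕ [15] (152)–(153) for the RECORD structure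
at the print datum of every grid cube of every separated run, rows 1–8 of dag-n07-e's `HThm4RecDbar` plus the door's member rows, from the TREE's theorems (R1–R8, the Cov facts, the
R7 door, the knit) with no displayed R6 premise.  (§1 ∘ p735717 `hThm4RecMember_uniform_of_recordCrownSU`.)
[cite: Balaban1985RegularSpaces, Thm. 4 p.88, Prop. 6 (1.130)–(1.138) pp.98–99; Balaban1985Variational, (144) p.300, (152)–(153) p.301, (163) p.304; Balaban1987RG1, (0.4) p.253, (0.11) pp.253–254] -/
theorem hThm4RecMember_uniform_holds (hN : N ≤ 12) (Mc : ℕ) :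
    ∃ ρmin : ℕ, ∃ B₁ c₁' : ℝ, 1 ≤ ρmin ∧ 0 ≤ B₁ ∧ 0 < c₁' ∧ ∀ ρ₀ : ℕ, ρmin ∣ ρ₀ → 1 ≤ ρ₀ → ∀ hρ : F.L ≤ ρ₀ * F.L,
      HThm4RecMember F N Mc (ρ₀ * F.L) hρ (b9OfP F Mc (ρ₀ * F.L) B₁) (a0OfP F N Mc (ρ₀ * F.L) B₁ c₁') :=
  hThm4RecMember_uniform_of_recordCrownSU F N (recordCrownSU_holds F N hN) Mc

/-! ## §3  The same for `N ≤ 25` (appended 2026-08-29 ≈19:15Z on dag-n05-e g41's sharp `SU(N)` closure of record) -/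

/-- ★★ **THE `SU(N)` RECORD CROWN INHABITS THE JUNCTION's PREMISE SHAPE FOR `N ≤ 25`** — dag-n05-e g41's sibling of (G8) with the SHARP averaging-closedness of `SU(N)` for the record
(`B7Prop2SpecialUnitarySharpRec.avgClosedZ_specialUnitary_of_le`: loop radius `¼ < 2 sin(π∕N)` iff `N ≤ 25`), at `d := 4`, `L := F.L`.
[cite: Balaban1985RegularSpaces, Prop. 6 (1.135)–(1.138) p.99, p.76 («G = SU(N)»); Balaban1985Averaging, p.20, (22)–(23) p.21, (42)–(43) pp.23–24; Balaban1987RG1, (0.3)–(0.4) pp.252–253] -/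
theorem recordCrownSU_holds_of_le (hN : N ≤ 25) : RecordCrownSU F.L N := by
  obtain ⟨sL, hsL⟩ := F.hL.1
  have hs2 : 2 ≤ sL := by have := F.hL11; omega
  letI : CStarAlgebra (MatA N) := {}
  exact B8Prop6DentedCubeMemberScalarGammaSU25Rec.gaugedBoundB8DZ_dentedMember_scalar_γ_holds_specialUnitary_of_le (d := 4) (by norm_num) hsL hs2 hN

/-- ★★★ **THE N05-REC → K-ROAD JUNCTION, END TO END, FOR `N ≤ 25`**: §2's `hThm4RecMember_uniform_holds` with the cap `12 ↦ 25` (§3's inhabitant ∘ p735717 `hThm4RecMember_uniform_of_recordCrownSU`).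
[cite: Balaban1985RegularSpaces, Thm. 4 p.88, Prop. 6 (1.130)–(1.138) pp.98–99; Balaban1985Variational, (144) p.300, (152)–(153) p.301, (163) p.304; Balaban1987RG1, (0.4) p.253, (0.11) pp.253–254] -/
theorem hThm4RecMember_uniform_holds_of_le (hN : N ≤ 25) (Mc : ℕ) :
    ∃ ρmin : ℕ, ∃ B₁ c₁' : ℝ, 1 ≤ ρmin ∧ 0 ≤ B₁ ∧ 0 < c₁' ∧ ∀ ρ₀ : ℕ, ρmin ∣ ρ₀ → 1 ≤ ρ₀ → ∀ hρ : F.L ≤ ρ₀ * F.L,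
      HThm4RecMember F N Mc (ρ₀ * F.L) hρ (b9OfP F Mc (ρ₀ * F.L) B₁) (a0OfP F N Mc (ρ₀ * F.L) B₁ c₁') :=
  hThm4RecMember_uniform_of_recordCrownSU F N (recordCrownSU_holds_of_le F N hN) Mc

end Summit.QuantumFields.YangMills.BalabanUVNodes.N07Thm4RecMemberOfRecordCrownSU

end
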